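import Summits.CriticalPhenomena.PercolationContinuityZ3.Theorems.PercNearOneGluingNoHeavyPcintMemCertZ3T8TwoSided
import Summits.CriticalPhenomena.PercolationContinuityZ3.Theorems.PercNearOneGluingNoHeavyPcintClosingOctagonsZ3Exact
import Summits.CriticalPhenomena.PercolationContinuityZ3.Theorems.PercNearOneGluingNoHeavyPcintLoopExclusionRungSixZ3
import HarnessLib

/-!
# CriticalPhenomena/PercolationContinuityZ3 — Theorems/PercNearOneGluingNoHeavyPcintLoopExclusionRungEightZ3.lean: the THIRD rung of the typed law C4 on `ℤ³` — `0.52 ≤ R_8(ℤ³) ≤ 0.54 < 0.58 ≤ R_6(ℤ³)`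

Lane prim-pcint, STRUCTURE rule.  The loop-exclusion factors of `ℤ³` are now certified three rungs deep:
`R_4(ℤ³) ≥ 0.70` (…RungSixZ3), `R_6(ℤ³) ∈ [0.58, 0.60]` (…RungSixZ3), and here **`R_8(ℤ³) ≤ 0.54`** from the two-sided
memory-8 certificate (`Δ_8(ℤ³) ≤ 0.0062`, …MemCertZ3T8TwoSided), the two-sided memory-6 certificate (`μ_6(ℤ³) ≤ 4.8074125`,
…MemCertZ3T6) and the EXACT octagon count `2·8·p_8(ℤ³) = 3312` (…ClosingOctagonsZ3Exact): `f_8(ℤ³) = 3312/μ_6⁸ ∈ [3312/4.8074125⁸, 3312/4.8074093⁸]`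
(`memLoopDensity_eight_zd3_ge/le`), **`0.52 ≤ R_8(ℤ³) ≤ 0.54`** (`loopCompat_eight_zd3_ge/le`; measured 0.5292).  Hence
**`loopCompat_eight_lt_six_zd3 : R_8(ℤ³) < R_6(ℤ³)`** — clause (c) `loopCompatStrictAntiMemory` at `(d, m) = (3, 3)`, the
column `R_4(ℤ³) > R_6(ℤ³) > R_8(ℤ³)` strictly decreasing over the first three rungs — and **`loopCompatWindow_three_four`:
`0 < R_8(ℤ³) < 1`** (clause (a) at `(3, 4)`).

HONEST FRAMING: elementary consequences of kernel certificates and kernel-checked witnesses; nothing here is used by a certified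
`p_c` cell.  Written by prim-pcint-2 gen 17 (prover-prim-pcint-2-g17-0), 2026-08-25.
-/

noncomputable section

open Literature.Probability.LatticeModels Literature.Probability.Percolation
open Summit.CriticalPhenomena.PercolationContinuityZ3.Theorems.Pcint

namespace Summit.CriticalPhenomena.PercolationContinuityZ3.Theorems.Pcint.MemoryTail

/-- **`f_8(ℤ³) ≥ 3312/4.8074125⁸`** (`≈ 0.011609`; `f_8 = closingCount 3 8/μ_6⁸`). [this work] -/
theorem memLoopDensity_eight_zd3_ge : (3312 : ℝ) / 4.8074125 ^ 8 ≤ memLoopDensity 3 8 := by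
  unfold memLoopDensity
  rw [show (8 : ℕ) - 2 = 6 from rfl]
  have hμlo : (4.8074093 : ℝ) ≤ memGrowth 3 6 := le_trans (by norm_num) memGrowth_six_zd3_ge
  have hμhi : memGrowth 3 6 ≤ 4.8074125 := le_trans memGrowth_six_zd3_le (by norm_num)
  have hμpos : (0 : ℝ) < memGrowth 3 6 := by linarith
  have hcc : ((closingCount 3 8 : ℕ) : ℝ) = 3312 := by rw [closingCount_eight_zd3]; norm_num
  rw [hcc]
  exact div_le_div_of_nonneg_left (by norm_num) (by positivity) (pow_le_pow_left₀ hμpos.le hμhi 8)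

/-- **`f_8(ℤ³) ≤ 3312/4.8074093⁸`**. [this work] -/
theorem memLoopDensity_eight_zd3_le : memLoopDensity 3 8 ≤ (3312 : ℝ) / 4.8074093 ^ 8 := by
  unfold memLoopDensity
  rw [show (8 : ℕ) - 2 = 6 from rfl]
  have hμlo : (4.8074093 : ℝ) ≤ memGrowth 3 6 := le_trans (by norm_num) memGrowth_six_zd3_ge
  have hcc : ((closingCount 3 8 : ℕ) : ℝ) = 3312 := by rw [closingCount_eight_zd3]; norm_num
  rw [hcc]
  exact div_le_div_of_nonneg_left (by norm_num) (by positivity) (pow_le_pow_left₀ (by norm_num) hμlo 8)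

/-- `f_8(ℤ³) > 0`. [this work] -/
theorem memLoopDensity_eight_zd3_pos : 0 < memLoopDensity 3 8 :=
  lt_of_lt_of_le (by norm_num) memLoopDensity_eight_zd3_ge

/-- **`R_8(ℤ³) ≤ 0.54`** (measured 0.5292). [this work] -/
theorem loopCompat_eight_zd3_le : loopCompat 3 8 ≤ 0.54 := by
  unfold loopCompat
  have hf := memLoopDensity_eight_zd3_ge
  have hfpos := memLoopDensity_eight_zd3_pos
  have hΔ := memLoopCost_eight_zd3_bounds.2
  rw [div_le_iff₀ hfpos]
  have : (0.0062 : ℝ) ≤ 0.54 * ((3312 : ℝ) / 4.8074125 ^ 8) := by norm_num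
  nlinarith

/-- **`0.52 ≤ R_8(ℤ³)`** (`Δ_8(ℤ³) ≥ 0.0061`, `f_8(ℤ³) ≤ 3312/4.8074093⁸`). [this work] -/
theorem loopCompat_eight_zd3_ge : (0.52 : ℝ) ≤ loopCompat 3 8 := by
  unfold loopCompat
  have hf := memLoopDensity_eight_zd3_le
  have hfpos := memLoopDensity_eight_zd3_pos
  have hΔ := memLoopCost_eight_zd3_bounds.1
  rw [le_div_iff₀ hfpos]
  have : 0.52 * ((3312 : ℝ) / 4.8074093 ^ 8) ≤ 0.0061 := by norm_num
  nlinarith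

/-- **`R_8(ℤ³) < R_6(ℤ³)`**: clause (c) of C4 at `(d, m) = (3, 3)` — with `loopCompat_six_lt_four_zd3`, the column
`R_4(ℤ³) > R_6(ℤ³) > R_8(ℤ³)`. [this work] -/
theorem loopCompat_eight_lt_six_zd3 : loopCompat 3 8 < loopCompat 3 6 :=
  lt_of_le_of_lt loopCompat_eight_zd3_le (lt_of_lt_of_le (by norm_num) loopCompat_six_zd3_ge)

/-- `loopCompatStrictAntiMemory` at `(3, 3)`: `R_{2·3+2}(3) < R_{2·3}(3)`. [this work] -/
theorem loopCompatStrictAntiMemory_three_three : loopCompat 3 (2 * 3 + 2) < loopCompat 3 (2 * 3) :=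
  loopCompat_eight_lt_six_zd3

/-- `loopCompatWindow` at `(3, 4)`: `0 < R_8(ℤ³) < 1`. [this work] -/
theorem loopCompatWindow_three_four : 0 < loopCompat 3 (2 * 4) ∧ loopCompat 3 (2 * 4) < 1 :=
  ⟨loopCompat_eight_zd3_pos, lt_of_le_of_lt loopCompat_eight_zd3_le (by norm_num)⟩

/-- **The first three rungs of `ℤ³` are strictly ordered: `R_8(ℤ³) < R_6(ℤ³) < R_4(ℤ³) < 1`.** [this work] -/
theorem loopCompat_chain_zd3 : loopCompat 3 8 < loopCompat 3 6 ∧ loopCompat 3 6 < loopCompat 3 4 ∧ loopCompat 3 4 < 1 :=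
  ⟨loopCompat_eight_lt_six_zd3, loopCompat_six_lt_four_zd3, lt_of_le_of_lt loopCompat_four_zd3_le (by norm_num)⟩

end Summit.CriticalPhenomena.PercolationContinuityZ3.Theorems.Pcint.MemoryTail
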